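import Mathlib
import Summits.ValiantsHypothesis.ValiantsHypothesis.Theses.ForgivenCollisions
import Literature.Computability.AlgebraicComplexity.CosetComplexity
import Literature.Computability.AlgebraicComplexity.CircuitDepth
import Literature.Computability.AlgebraicComplexity.HomogeneousCircuits

/-!
# FirstRung — crux-strategist census artefacts (planner cstrat, unit cstrat-stmt-ValiantsHypothesis-11563-r1, 2026-08-17)

Typed companions of `Cruxes/FirstRung/STRATEGY-CENSUS.md` (this file: `Cruxes/FirstRung/NegationSkeleton.lean`) for the crux
`Summit.ValiantsHypothesis.ValiantsHypothesis.Theses.ForgivenCollisions.FirstRung`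
(item stmt-ValiantsHypothesis-11563: `∃ δ > 0, ∃ n₀, ∀ n ≥ n₀, n^(2+δ) ≤ κ_3(n)`).

* `## Negation` — the crux is FALSE. `witness n` is the refuter's explicit quadratic representative of
  `per_n` modulo `J_3(n)` (evidence on the item, 2026-08-15; re-verified by the planner, census §1);
  `WitnessMem` / `WitnessCost` are the two statements a Theorems file has to prove, and
  `not_firstRung_of` (sorry-free) is the composition `WitnessMem → WitnessCost → ¬ FirstRung`
  through the generic `not_firstRung_of_quadratic`.
* `## Strengthen` / `## Decomposition` — the typed candidates discussed in the census (`HomRung`,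
  `FormulaRung`, the model-transfer template `ModelLowerBound` / `ModelConversion`), elaboration only.

Nothing here is a route item; nothing is proved about the witness itself (planners do not prove).
-/

set_option linter.dupNamespace false

noncomputable section

open MvPolynomial Literature.Computability.AlgebraicComplexity

namespace Summit.ValiantsHypothesis.ValiantsHypothesis.Cruxes.FirstRung.Census

open Summit.ValiantsHypothesis.ValiantsHypothesis.Theses.ForgivenCollisions (FirstRung)

/-- The collision ideal `J_3(n)` — verbatim the ideal inside `FirstRung`. -/
abbrev J3 (n : ℕ) : Ideal (MvPolynomial (Fin n × Fin n) ℂ) :=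
  Ideal.span ((fun d : Fin n × Fin n →₀ ℕ => MvPolynomial.monomial d (1 : ℂ)) ''
    {d | ((∃ i : Fin n, 3 ≤ rowCount d i) ∨ (∃ j : Fin n, 3 ≤ colCount d j) ∨
      3 ≤ (Finset.univ.filter fun i : Fin n => 2 ≤ rowCount d i).card +
        (Finset.univ.filter fun j : Fin n => 2 ≤ colCount d j).card)})

/-- `κ_3(n)`, the quantity `FirstRung` bounds below. -/
abbrev κ₃ (n : ℕ) : ℕ := cosetComplexity (J3 n) (perPoly (Fin n) ℂ)

/-- Read-back: `FirstRung` is literally `∃ δ > 0, ∃ n₀, ∀ n ≥ n₀, n^(2+δ) ≤ κ_3(n)`. -/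
theorem firstRung_iff :
    FirstRung ↔ ∃ δ : ℝ, 0 < δ ∧ ∃ n₀ : ℕ, ∀ n : ℕ, n₀ ≤ n → (n : ℝ) ^ (2 + δ) ≤ ((κ₃ n : ℕ) : ℝ) :=
  Iff.rfl

/-! ## Negation: the quadratic witness -/

/-- `S = ∑ x_ic`. -/
def Ssum (n : ℕ) : MvPolynomial (Fin n × Fin n) ℂ := ∑ v : Fin n × Fin n, X v
/-- `R_i = ∑_c x_ic`. -/
def rowSum (n : ℕ) (i : Fin n) : MvPolynomial (Fin n × Fin n) ℂ := ∑ c : Fin n, X (i, c)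
/-- `C_c = ∑_i x_ic`. -/
def colSum (n : ℕ) (c : Fin n) : MvPolynomial (Fin n × Fin n) ℂ := ∑ i : Fin n, X (i, c)
/-- `Q = ∑ x_ic²`. -/
def sqSum (n : ℕ) : MvPolynomial (Fin n × Fin n) ℂ := ∑ v : Fin n × Fin n, X v ^ 2
/-- `E_R + E_C = ½∑ R_i² + ½∑ C_c² − Q` (sum of the row and column second elementary symmetric
polynomials: the "cherry" pattern). -/
def cherries (n : ℕ) : MvPolynomial (Fin n × Fin n) ℂ :=
  (1 / 2 : ℂ) • (∑ i : Fin n, rowSum n i ^ 2) + (1 / 2 : ℂ) • (∑ c : Fin n, colSum n c ^ 2) - sqSum n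
/-- `W = ∑_ic x_ic R_i C_c` (the length-3 path pattern `c' – i – c – i'`). -/
def pathSum (n : ℕ) : MvPolynomial (Fin n × Fin n) ℂ :=
  ∑ v : Fin n × Fin n, X v * rowSum n v.1 * colSum n v.2

/-- The refuter's representative `P_n = S^n/n! − S^(n−2)/(n−2)!·(E_R+E_C+Q/2)
+ S^(n−4)/(n−4)!·(E_R+E_C)²/2 + S^(n−3)/(n−3)!·W` (meant for `n ≥ 4`). -/
def witness (n : ℕ) : MvPolynomial (Fin n × Fin n) ℂ :=
  (1 / (n.factorial : ℂ)) • Ssum n ^ n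
  - (1 / ((n - 2).factorial : ℂ)) • (Ssum n ^ (n - 2) * (cherries n + (1 / 2 : ℂ) • sqSum n))
  + (1 / (2 * ((n - 4).factorial : ℂ))) • (Ssum n ^ (n - 4) * cherries n ^ 2)
  + (1 / ((n - 3).factorial : ℂ)) • (Ssum n ^ (n - 3) * pathSum n)

/-- NegA (to be proved in Theorems): the witness lies in the coset `per_n + J_3(n)` for `n ≥ 4`. -/
def WitnessMem : Prop := ∀ n : ℕ, 4 ≤ n → witness n - perPoly (Fin n) ℂ ∈ J3 n

/-- NegB (to be proved in Theorems): the witness has quadratic circuit complexity. -/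
def WitnessCost : Prop := ∃ C : ℕ, ∀ n : ℕ, 4 ≤ n → complexity (witness n) ≤ C * n ^ 2

/-- Generic: a quadratic upper bound on `κ_3` from some point on refutes `FirstRung`. -/
theorem not_firstRung_of_quadratic
    (h : ∃ C n₁ : ℕ, ∀ n : ℕ, n₁ ≤ n → κ₃ n ≤ C * n ^ 2) : ¬ FirstRung := by
  rintro ⟨δ, hδ, n₀, hlow⟩
  obtain ⟨C, n₁, hup⟩ := h
  have hev : ∀ᶠ n : ℕ in Filter.atTop, (C : ℝ) + 1 ≤ (n : ℝ) ^ δ := by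
    have ht : Filter.Tendsto (fun n : ℕ => (n : ℝ) ^ δ) Filter.atTop Filter.atTop :=
      (tendsto_rpow_atTop hδ).comp tendsto_natCast_atTop_atTop
    exact ht.eventually (Filter.eventually_ge_atTop _)
  obtain ⟨N, hN⟩ := Filter.eventually_atTop.1 hev
  set n : ℕ := max (max n₀ n₁) (max N 1) with hn
  have hn₀ : n₀ ≤ n := le_trans (le_max_left _ _) (le_max_left _ _)
  have hn₁ : n₁ ≤ n := le_trans (le_max_right _ _) (le_max_left _ _)
  have hN' : N ≤ n := le_trans (le_max_left _ _) (le_max_right _ _)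
  have h1 : 1 ≤ n := le_trans (le_max_right _ _) (le_max_right _ _)
  have hpos : (0 : ℝ) < n := by exact_mod_cast h1
  have hA := hlow n hn₀
  have hB : ((κ₃ n : ℕ) : ℝ) ≤ (C : ℝ) * (n : ℝ) ^ 2 := by exact_mod_cast hup n hn₁
  have hCδ := hN n hN'
  have hsplit : (n : ℝ) ^ (2 + δ) = (n : ℝ) ^ 2 * (n : ℝ) ^ δ := by
    rw [Real.rpow_add hpos, Real.rpow_two]
  have hn2 : (0 : ℝ) < (n : ℝ) ^ 2 := by positivity
  have key : (n : ℝ) ^ 2 * ((C : ℝ) + 1) ≤ (C : ℝ) * (n : ℝ) ^ 2 := by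
    calc (n : ℝ) ^ 2 * ((C : ℝ) + 1) ≤ (n : ℝ) ^ 2 * (n : ℝ) ^ δ := by gcongr
      _ = (n : ℝ) ^ (2 + δ) := hsplit.symm
      _ ≤ ((κ₃ n : ℕ) : ℝ) := hA
      _ ≤ (C : ℝ) * (n : ℝ) ^ 2 := hB
  nlinarith

/-- The composition: the two witness statements refute the crux. -/
theorem not_firstRung_of (hA : WitnessMem) (hB : WitnessCost) : ¬ FirstRung := by
  apply not_firstRung_of_quadratic
  obtain ⟨C, hC⟩ := hB
  refine ⟨C, 4, fun n hn => ?_⟩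
  calc κ₃ n ≤ complexity (witness n) :=
        cosetComplexity_le_iff_sub_mem.2 ⟨witness n, hA n hn, le_rfl⟩
    _ ≤ C * n ^ 2 := hC n hn

/-! ## Strengthen / Decomposition: typed candidates from the census (elaboration only) -/

/-- S⁺ (homogeneous model with the homogenization loss `n²` paid in advance): every syntactically
homogeneous fan-in-two circuit computing a member of `per_n + J_3(n)` has `≥ n^(4+δ)` gates.
FALSE: the witness is computed by a homogeneous circuit with `O(n²)` gates (census §2, §4). -/
def HomRung : Prop :=
  ∃ δ : ℝ, 0 < δ ∧ ∃ n₀ : ℕ, ∀ n : ℕ, n₀ ≤ n →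
    ∀ (P : MvPolynomial (Fin n × Fin n) ℂ) (Φ : ArithCircuit ℂ (Fin n × Fin n)),
      P - perPoly (Fin n) ℂ ∈ J3 n → Φ.IsFanInTwo → Φ.IsHomogeneousCircuit → Φ.Computes P →
        (n : ℝ) ^ (4 + δ) ≤ (Φ.size : ℝ)

/-- Formula rung (restricted model, plausibly TRUE, attackable by Kalorkoti's transcendence-degree
measure made garbage-immune): every fan-in-two FORMULA for a member of `per_n + J_3(n)` has
`≥ n^(2+δ)` gates. Not a piece of `FirstRung` (formulas ⊂ circuits is the wrong direction) and not
refuted by the witness (as a formula the witness costs `Θ(n³)`). Census §4. -/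
def FormulaRung : Prop :=
  ∃ δ : ℝ, 0 < δ ∧ ∃ n₀ : ℕ, ∀ n : ℕ, n₀ ≤ n →
    ∀ P : MvPolynomial (Fin n × Fin n) ℂ, P - perPoly (Fin n) ℂ ∈ J3 n →
      (n : ℝ) ^ (2 + δ) ≤ ((formulaComplexity P : ℕ) : ℝ)

/-- Model-transfer template, piece 1: a lower bound with exponent `c` for coset members in a
circuit class `M`. -/
def ModelLowerBound (M : ∀ n : ℕ, ArithCircuit ℂ (Fin n × Fin n) → Prop) (c : ℝ) : Prop :=
  ∃ n₀ : ℕ, ∀ n : ℕ, n₀ ≤ n →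
    ∀ (P : MvPolynomial (Fin n × Fin n) ℂ) (Φ : ArithCircuit ℂ (Fin n × Fin n)),
      P - perPoly (Fin n) ℂ ∈ J3 n → M n Φ → Φ.IsFanInTwo → Φ.Computes P → (n : ℝ) ^ c ≤ (Φ.size : ℝ)

/-- Model-transfer template, piece 2: general circuits for coset members convert into class `M`
(possibly changing the representative) at polynomial cost with exponent `a`. -/
def ModelConversion (M : ∀ n : ℕ, ArithCircuit ℂ (Fin n × Fin n) → Prop) (a : ℝ) : Prop :=
  ∃ K : ℝ, 0 < K ∧ ∀ (n : ℕ) (P : MvPolynomial (Fin n × Fin n) ℂ) (Φ : ArithCircuit ℂ (Fin n × Fin n)),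
    P - perPoly (Fin n) ℂ ∈ J3 n → Φ.IsFanInTwo → Φ.Computes P →
      ∃ (P' : MvPolynomial (Fin n × Fin n) ℂ) (Φ' : ArithCircuit ℂ (Fin n × Fin n)),
        P' - perPoly (Fin n) ℂ ∈ J3 n ∧ M n Φ' ∧ Φ'.IsFanInTwo ∧ Φ'.Computes P' ∧
          (Φ'.size : ℝ) ≤ K * ((Φ.size : ℝ) + 1) ^ a

end Summit.ValiantsHypothesis.ValiantsHypothesis.Cruxes.FirstRung.Census
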